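import Summits.ValiantsHypothesis.ValiantsHypothesis.Theorems.GrenetZeonDualUnipotentThreeHalvesHeavyTopPatternPlacement
import Summits.ValiantsHypothesis.ValiantsHypothesis.Theorems.GrenetZeonDualUnipotentThreeHalvesSlowCoreDefs

/-!
# `GrenetZeon.DualUnipotentThreeHalves` (stmt-ValiantsHypothesis-24318), R2 / R2ᵖ instance grids — COORDINATE PATTERN PENCILS IN POWER CURRENCY:
# Lemma A for word SUMS, the expansion `(T₀ + s•T₁)^L = Σ_w s^{#T₁(w)} w`, and the path-placement criterion against `Slow`

Experiment cell «val-heavytop-census» (D-0160), engine seat val-htc-eng-2 (g2).  The successor head currency of 24318 is POWER (director-valiant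
R306/R307/R310: R2ᵖ `HeavyTopSlowLaw`, conclusion `Slow n m N` of ✓ `…SlowCoreDefs`; line `slow_core`, val-port-2 g3), and the census close-out
(CENSUS-GRID v0.6b §0 (G)) booked the successor item «re-decide the ✗ cells in `Slow` currency in the kernel (pattern path-degree lemma + the
coordinate reduction as an explicit hypothesis H)».  This file does it WITHOUT any hypothesis H: MEMO-g3's Lemma A (val-idea-28 g3) holds in the
kernel for SUMS of words exactly as for words (✓ `words_vanish_on_coordinate_of_vanish`), and S3's degree bound on `N(x + s v)^{n−1}` IS the
vanishing of the word sums with `> k` tops (MEMO-g3 §3).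

* `add_smul_pow_eq_sum_gword` — noncommutative binomial expansion `(T₀ + c•T₁)^L = Σ_{f : Fin L → Bool} c^{#true f} • w_f(T₀,T₁)` (any
  comm. semiring).
* `patPencil_map_lineSubst` — the pattern pencil along a line: `N(x + s v) = patTop x + s·patTop v`; `coeff_pow_line_eq_sum_gword` — the
  `s^j`-coefficient of an entry of `(A + s B)^L` is that entry of the SUM of the words of length `L` with exactly `j` letters `B`.
* ★★ `wordsums_vanish_on_coordinate_of_vanish` — LEMMA A FOR WORD SUMS (same initial-coordinate / polynomial-degeneration / torus-intertwining proof;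
  intertwining and evaluation are additive).
* `wordsum_indicator_ne_zero` — Lemma B for sums: on the `0/1` letters `(A_D, A_E)` every word has entries in `ℕ`, so the sum of all words of
  length `s` with `j` indicator letters is nonzero as soon as a row path of the placement meets `E` in exactly `j` edges.
* ★★★ `exists_not_slow_of_placement` (+ `_le`) — THE PATH-PLACEMENT CRITERION IN POWER CURRENCY: under the hypotheses of
  ✓ `not_heavyTopInst_of_placement` (rows `V a` = `s+1` edge-disjoint directed `s`-paths, `s+1` extra entries, all distinct, `s + 1 ≤ 16`) the
  pattern pencil is affine, nilpotent, heavy-top and NOT `Slow (s+1) m` — i.e. the INSTANCE of R2ᵖ at `(s+1, m)` is false.  Instances for every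
  admissible cell with `m > m*_tri(n)`, `n = 3..9`, in `…DualUnipotentThreeHalves/Negative/HeavyTopSlowInstPatterns`.

Honest framing.  `--supports stmt-ValiantsHypothesis-24318 --as helper`.  Consequence for the record: the `C₀ = 1` sliver cells that fail
  R2's instance
table fail R2ᵖ's too (power currency does not rescue tiny `n`; `C₀ ≥ 2` or `n₀` large is forced for R2ᵖ exactly as for R2) — this says NOTHING about
R2ᵖ `HeavyTopSlowLaw` itself (`∃ C₀ n₀ …`), which is OPEN, as are IRR/RED, S3, the crux 24318, rung 8062 and `VP ≠ VNP`.
[MEMO-g3 §1, §3; ✓ `…HeavyTopPatternPlacement`; ✓ `…SlowCoreDefs` (`Slow`); this seat]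
-/

-- `Summit.ValiantsHypothesis.ValiantsHypothesis.…` repeats a component (D-0017 layout); `dupNamespace` would flag the mandated name.
set_option linter.dupNamespace false
set_option autoImplicit false

noncomputable section

namespace Summit.ValiantsHypothesis.ValiantsHypothesis.Theorems.GrenetZeon.RadicalSplit

open MvPolynomial Matrix
open scoped BigOperators
open Summit.ValiantsHypothesis.ValiantsHypothesis.Cruxes.TwoDimCoefficients.DimTwoCases (AffMat IsAffine)

section SlowTwin

open Summit.ValiantsHypothesis.ValiantsHypothesis.Theorems.GrenetZeon.SlowCore (Slow)

variable {n m : ℕ}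

/-- **Noncommutative binomial expansion into words**: `(T₀ + c•T₁)^L = Σ_{f : Fin L → Bool} c^{#true f} • w_f(T₀, T₁)`. -/
theorem add_smul_pow_eq_sum_gword {R : Type*} [CommSemiring R] (T₀ T₁ : Matrix (Fin m) (Fin m) R) (c : R) :
    ∀ L : ℕ, (T₀ + c • T₁) ^ L =
      ∑ f : Fin L → Bool, c ^ ((List.ofFn f).count true) • gword T₀ T₁ (List.ofFn f)
  | 0 => by simp [gword_nil]
  | L + 1 => by
    rw [pow_succ', add_smul_pow_eq_sum_gword T₀ T₁ c L, Finset.mul_sum,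
      ← (Fin.consEquiv fun _ : Fin (L + 1) => Bool).sum_comp, Fintype.sum_prod_type, Fintype.sum_bool,
      ← Finset.sum_add_distrib]
    refine Finset.sum_congr rfl fun f _ => ?_
    have h1 : List.ofFn ((Fin.consEquiv fun _ : Fin (L + 1) => Bool) (true, f)) = true :: List.ofFn f := by
      rw [List.ofFn_succ]
      simp [Fin.consEquiv]
    have h2 : List.ofFn ((Fin.consEquiv fun _ : Fin (L + 1) => Bool) (false, f)) = false :: List.ofFn f := by
      rw [List.ofFn_succ]
      simp [Fin.consEquiv]
    rw [h1, h2, gword_cons, gword_cons, List.count_cons, List.count_cons]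
    simp only [beq_self_eq_true, show (false == true) = false from rfl, ↓reduceIte, Bool.false_eq_true, add_zero, pow_succ,
      add_mul, Matrix.smul_mul, Matrix.mul_smul, smul_smul]
    rw [add_comm, mul_comm (c ^ _) c]

/-- The pattern pencil along the line `x + s·v`: `N(x + s v) = patTop x + s · patTop v` (entries in `ℂ[s] = MvPolynomial (Fin 1) ℂ`). -/
theorem patPencil_map_lineSubst (pos : Fin n × Fin n → Fin m × Fin m) (x v : Fin n × Fin n → ℂ) :
    (patPencil pos).map (lineSubst x v) =
      (patTop pos x).map MvPolynomial.C + (MvPolynomial.X 0 : MvPolynomial (Fin 1) ℂ) • (patTop pos v).map MvPolynomial.C := by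
  unfold patPencil
  rw [patTop_map, patTop_map, patTop_map, ← patTop_smul, ← patTop_add]
  congr 1
  funext c
  simp [lineSubst, mul_comm]

/-- **Coefficient extraction**: the `s^j`-coefficient of an entry of `(A + s·B)^L` is the same entry of the SUM of the words of length `L`
with exactly `j` letters `B`. -/
theorem coeff_pow_line_eq_sum_gword (A B : Matrix (Fin m) (Fin m) ℂ) (L j : ℕ) (i i' : Fin m) :
    MvPolynomial.coeff (Finsupp.single 0 j)
        (((A.map MvPolynomial.C + (MvPolynomial.X 0 : MvPolynomial (Fin 1) ℂ) • B.map MvPolynomial.C :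
          Matrix (Fin m) (Fin m) (MvPolynomial (Fin 1) ℂ)) ^ L) i i') =
      (∑ f ∈ Finset.univ.filter (fun f : Fin L → Bool => (List.ofFn f).count true = j), gword A B (List.ofFn f)) i i' := by
  classical
  rw [add_smul_pow_eq_sum_gword, Matrix.sum_apply, MvPolynomial.coeff_sum, Matrix.sum_apply, Finset.sum_filter]
  refine Finset.sum_congr rfl fun f _ => ?_
  rw [Matrix.smul_apply, ← gword_map, Matrix.map_apply, smul_eq_mul, MvPolynomial.X_pow_eq_monomial, MvPolynomial.C_apply,
    MvPolynomial.monomial_mul, add_zero, one_mul, MvPolynomial.coeff_monomial]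
  by_cases h : (List.ofFn f).count true = j
  · simp [h]
  · rw [if_neg h, if_neg]
    intro h'
    exact h (Finsupp.single_injective (0 : Fin 1) h')

/-- **Lemma A for word SUMS** (the form the power currency needs): if a family of finite SUMS of words vanishes on every pair
`(patTop x, patTop v)`, `v ∈ K`, it vanishes on every pair `(patTop x, patTop u)` with `u` supported on a coordinate set `E`, `dim K ≤ |E|`
(the initial coordinates of `K`).  Same proof as `words_vanish_on_coordinate_of_vanish` (intertwining and evaluation are additive). -/
theorem wordsums_vanish_on_coordinate_of_vanish (pos : Fin n × Fin n → Fin m × Fin m) (hinj : Function.Injective pos)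
    (hup : ∀ c, (pos c).1 < (pos c).2) (K : Submodule ℂ (Fin n × Fin n → ℂ)) (𝒮 : Set (Finset (List Bool)))
    (hK : ∀ x v : Fin n × Fin n → ℂ, v ∈ K → ∀ S ∈ 𝒮, ∑ w ∈ S, word (patTop pos x) (patTop pos v) w = 0) :
    ∃ E : Finset (Fin n × Fin n), Module.finrank ℂ K ≤ E.card ∧
      ∀ x u : Fin n × Fin n → ℂ, (∀ c, c ∉ E → u c = 0) → ∀ S ∈ 𝒮, ∑ w ∈ S, word (patTop pos x) (patTop pos u) w = 0 := by
  classical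
  have hwinj := wt_injective pos hinj hup
  set L := Finset.univ.filter fun c => ∃ v ∈ K, v c ≠ 0 ∧ ∀ c', wt pos c' < wt pos c → v c' = 0 with hL
  refine ⟨L, finrank_le_card_initial pos K, ?_⟩
  intro x u hu S hS
  have hb : ∀ c : Fin n × Fin n, ∃ b : Fin n × Fin n → ℂ,
      c ∈ L → b ∈ K ∧ b c = 1 ∧ ∀ c', wt pos c' < wt pos c → b c' = 0 := by
    intro c
    by_cases hc : c ∈ L
    · obtain ⟨v, hv, hvc, hv'⟩ : ∃ v ∈ K, v c ≠ 0 ∧ ∀ c', wt pos c' < wt pos c → v c' = 0 := by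
        simpa [hL] using hc
      refine ⟨(v c)⁻¹ • v, fun _ => ⟨K.smul_mem _ hv, by simp [hvc], fun c' hc' => by simp [hv' c' hc']⟩⟩
    · exact ⟨0, fun h => absurd h hc⟩
  choose b hb using hb
  have hbK : ∀ c ∈ L, b c ∈ K := fun c hc => (hb c hc).1
  have hbc : ∀ c ∈ L, b c c = 1 := fun c hc => (hb c hc).2.1
  have hb0 : ∀ c ∈ L, ∀ c', wt pos c' < wt pos c → b c c' = 0 := fun c hc => (hb c hc).2.2
  have hble : ∀ c ∈ L, ∀ c', b c c' ≠ 0 → wt pos c ≤ wt pos c' := fun c hc c' h => by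
    by_contra hlt
    exact h (hb0 c hc c' (by omega))
  let U : Fin n × Fin n → Polynomial ℂ := fun c' =>
    ∑ c ∈ L, Polynomial.C (u c * b c c') * Polynomial.X ^ (wt pos c' - wt pos c)
  have hU0 : (fun c' => (U c').eval 0) = u := by
    funext c'
    simp only [U, Polynomial.eval_finsetSum, Polynomial.eval_mul, Polynomial.eval_C, Polynomial.eval_pow,
      Polynomial.eval_X]
    by_cases hc' : c' ∈ L
    · rw [Finset.sum_eq_single c']
      · simp [hbc c' hc']
      · intro c hc hcc'
        by_cases hbz : b c c' = 0
        · simp [hbz]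
        · have hle := hble c hc c' hbz
          have hne : wt pos c ≠ wt pos c' := fun h => hcc' (hwinj h)
          have hpos : wt pos c' - wt pos c ≠ 0 := by omega
          simp [zero_pow hpos]
      · exact fun h => absurd hc' h
    · rw [hu c' hc']
      refine Finset.sum_eq_zero fun c hc => ?_
      by_cases hbz : b c c' = 0
      · simp [hbz]
      · have hle := hble c hc c' hbz
        have hne : wt pos c ≠ wt pos c' := fun h => hc' (hwinj h ▸ hc)
        have hpos : wt pos c' - wt pos c ≠ 0 := by omega
        simp [zero_pow hpos]
  have hUt : ∀ t : ℂ, t ≠ 0 → ∃ v ∈ K, (fun c' => (U c').eval t) = fun c' => t ^ wt pos c' * v c' := by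
    intro t ht
    refine ⟨∑ c ∈ L, (u c * t⁻¹ ^ wt pos c) • b c, K.sum_mem fun c hc => K.smul_mem _ (hbK c hc), ?_⟩
    funext c'
    simp only [U, Polynomial.eval_finsetSum, Polynomial.eval_mul, Polynomial.eval_C, Polynomial.eval_pow,
      Polynomial.eval_X, Finset.sum_apply, Pi.smul_apply, smul_eq_mul, Finset.mul_sum]
    refine Finset.sum_congr rfl fun c hc => ?_
    by_cases hbz : b c c' = 0
    · simp [hbz]
    · have hle := hble c hc c' hbz
      have hsplit : t ^ wt pos c' = t ^ (wt pos c' - wt pos c) * t ^ wt pos c := by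
        rw [← pow_add, Nat.sub_add_cancel hle]
      have hcancel : t ^ wt pos c * t⁻¹ ^ wt pos c = 1 := by
        rw [← mul_pow, mul_inv_cancel₀ ht, one_pow]
      calc u c * b c c' * t ^ (wt pos c' - wt pos c)
          = u c * b c c' * t ^ (wt pos c' - wt pos c) * (t ^ wt pos c * t⁻¹ ^ wt pos c) := by rw [hcancel, mul_one]
        _ = t ^ wt pos c' * (u c * t⁻¹ ^ wt pos c * b c c') := by rw [hsplit]; ring
  -- (C) the sums vanish along the family for every `t ≠ 0` (intertwining is additive)
  have hvan : ∀ t : ℂ, t ≠ 0 → ∑ w ∈ S, word (patTop pos x) (patTop pos fun c' => (U c').eval t) w = 0 := by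
    intro t ht
    obtain ⟨v, hvK, hv⟩ := hUt t ht
    rw [hv]
    set x' : Fin n × Fin n → ℂ := fun c => t⁻¹ ^ wt pos c * x c with hx'
    have hx : x = fun c => t ^ wt pos c * x' c := by
      funext c
      simp only [hx']
      rw [← mul_assoc, ← mul_pow, mul_inv_cancel₀ ht, one_pow, one_mul]
    set D := Matrix.diagonal fun i : Fin m => t ^ (2 ^ (i : ℕ)) with hD
    have hA := torus_patTop pos hup t x'
    have hB := torus_patTop pos hup t v
    rw [← hx] at hA
    have h0 : ∑ w ∈ S, word (patTop pos x') (patTop pos v) w = 0 := hK x' v hvK S hS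
    have hinter : D * ∑ w ∈ S, word (patTop pos x) (patTop pos fun c' => t ^ wt pos c' * v c') w =
        (∑ w ∈ S, word (patTop pos x') (patTop pos v) w) * D := by
      rw [Finset.mul_sum, Finset.sum_mul]
      refine Finset.sum_congr rfl fun w _ => ?_
      rw [word_eq_gword, word_eq_gword]
      exact gword_intertwine _ _ _ _ _ hA hB w
    rw [h0, Matrix.zero_mul] at hinter
    exact (isUnit_torus t ht).mul_left_cancel (hinter.trans (Matrix.mul_zero _).symm)
  -- (D) the polynomial identity
  let Wp : Matrix (Fin m) (Fin m) (Polynomial ℂ) := ∑ w ∈ S, gword ((patTop pos x).map Polynomial.C) (patTop pos U) w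
  have hWp : ∀ t : ℂ, (Polynomial.evalRingHom t).mapMatrix Wp =
      ∑ w ∈ S, gword (patTop pos x) (patTop pos fun c' => (U c').eval t) w := by
    intro t
    simp only [Wp, map_sum]
    refine Finset.sum_congr rfl fun w _ => ?_
    rw [RingHom.mapMatrix_apply, gword_map, Matrix.map_map, patTop_map]
    congr 1
    ext i j
    simp
  have hWp0 : Wp = 0 := by
    refine Matrix.ext fun i j => ?_
    apply Polynomial.eq_zero_of_infinite_isRoot
    refine ((Set.finite_singleton (0 : ℂ)).infinite_compl).mono fun t ht => ?_
    have ht' : t ≠ 0 := by simpa using ht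
    have h := congr_fun (congr_fun (hWp t) i) j
    have hv := hvan t ht'
    simp only [word_eq_gword] at hv
    rw [hv, RingHom.mapMatrix_apply, Matrix.map_apply, Polynomial.coe_evalRingHom] at h
    simpa [Polynomial.IsRoot] using h
  have h := hWp 0
  rw [hWp0, hU0] at h
  simp only [map_zero] at h
  simp only [word_eq_gword]
  exact h.symm

/-- Sums of `ℕ`-words along the row word: if the row path `a` of a placement meets `E` in exactly `j` edges, the SUM of all words of
length `s` with `j` indicator letters, read on the `0/1` letters `(A_D, A_E)`, is nonzero (every summand is entrywise `≥ 0` over `ℕ`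
and the row word contributes `≥ 1`, Lemma B). -/
theorem wordsum_indicator_ne_zero {s : ℕ} (V : Fin (s + 1) → Fin (s + 1) → Fin m) (X : Fin (s + 1) → Fin m × Fin m)
    (E : Finset (Fin (s + 1) × Fin (s + 1))) (a : Fin (s + 1)) (hs : 0 < s) :
    ∑ f ∈ Finset.univ.filter (fun f : Fin s → Bool => (List.ofFn f).count true =
        (List.ofFn fun i : Fin s => decide (((a, i.castSucc) : Fin (s + 1) × Fin (s + 1)) ∈ E)).count true),
      word (patTop (placement V X) fun _ => (1 : ℂ)) (patTop (placement V X) fun d => if d ∈ E then (1 : ℂ) else 0)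
        (List.ofFn f) ≠ 0 := by
  classical
  set pos := placement V X with hpos
  set fa : Fin s → Bool := fun i => decide (((a, i.castSucc) : Fin (s + 1) × Fin (s + 1)) ∈ E) with hfa
  -- the row path in `c :: l` form with its last edge
  obtain ⟨s', rfl⟩ : ∃ s', s = s' + 1 := ⟨s - 1, by omega⟩
  have hch := isChain_rowPath V X a
  have hofFn : (List.ofFn fun i : Fin (s' + 1) => ((a, i.castSucc) : Fin (s' + 2) × Fin (s' + 2))) =
      ((a, (0 : Fin (s' + 1)).castSucc) : Fin (s' + 2) × Fin (s' + 2)) ::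
        List.ofFn fun i : Fin s' => ((a, i.succ.castSucc) : Fin (s' + 2) × Fin (s' + 2)) := List.ofFn_succ
  rw [hofFn] at hch
  obtain ⟨c₁, hc₁⟩ : ∃ c₁, (((a, (0 : Fin (s' + 1)).castSucc) : Fin (s' + 2) × Fin (s' + 2)) ::
      List.ofFn fun i : Fin s' => ((a, i.succ.castSucc) : Fin (s' + 2) × Fin (s' + 2))).getLast? = some c₁ := by
    rw [List.getLast?_eq_getLast_of_ne_nil (List.cons_ne_nil _ _)]
    exact ⟨_, rfl⟩
  have h1 := one_le_gword_apply_of_isChain pos E _ _ c₁ hch hc₁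
  -- the labels of the row path are `List.ofFn fa`
  have hlabels : ((((a, (0 : Fin (s' + 1)).castSucc) : Fin (s' + 2) × Fin (s' + 2)) ::
      List.ofFn fun i : Fin s' => ((a, i.succ.castSucc) : Fin (s' + 2) × Fin (s' + 2))).map fun d => decide (d ∈ E)) =
      List.ofFn fa := by
    rw [← hofFn, List.map_ofFn]
    rfl
  rw [hlabels] at h1
  -- compare the ℕ-sum with the ℂ-sum
  intro h0
  have hcast : ((Nat.castRingHom ℂ).mapMatrix
      (∑ f ∈ Finset.univ.filter (fun f : Fin (s' + 1) → Bool => (List.ofFn f).count true = (List.ofFn fa).count true),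
        gword (patTop pos fun _ => (1 : ℕ)) (patTop pos fun d => if d ∈ E then 1 else 0) (List.ofFn f))) =
      ∑ f ∈ Finset.univ.filter (fun f : Fin (s' + 1) → Bool => (List.ofFn f).count true = (List.ofFn fa).count true),
        word (patTop pos fun _ => (1 : ℂ)) (patTop pos fun d => if d ∈ E then (1 : ℂ) else 0) (List.ofFn f) := by
    rw [map_sum]
    refine Finset.sum_congr rfl fun f _ => ?_
    rw [RingHom.mapMatrix_apply, gword_map, word_eq_gword, patTop_map, patTop_map]
    congr 2
    · funext d; simp
    · funext d; split_ifs <;> simp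
  have h2 := congr_fun (congr_fun (hcast.trans h0) (pos (a, (0 : Fin (s' + 1)).castSucc)).1) (pos c₁).2
  rw [RingHom.mapMatrix_apply, Matrix.map_apply, Matrix.zero_apply, eq_natCast, Nat.cast_eq_zero,
    Matrix.sum_apply] at h2
  have hfa_mem : fa ∈ Finset.univ.filter
      (fun f : Fin (s' + 1) → Bool => (List.ofFn f).count true = (List.ofFn fa).count true) := by simp
  have h3 := Finset.single_le_sum (f := fun f : Fin (s' + 1) → Bool =>
      gword (patTop pos fun _ => (1 : ℕ)) (patTop pos fun d => if d ∈ E then 1 else 0) (List.ofFn f)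
        (pos (a, (0 : Fin (s' + 1)).castSucc)).1 (pos c₁).2) (fun _ _ => Nat.zero_le _) hfa_mem
  omega

/-- **THE PATH-PLACEMENT CRITERION IN POWER CURRENCY** (instances of R2ᵖ `HeavyTopSlowLaw`): under the hypotheses of
`not_heavyTopInst_of_placement`, the pattern pencil `N` of the placement is affine, nilpotent, heavy-top (vacuously, `s + 1 ≤ 16`) and NOT
`Slow`: a slow certificate `(K, k)` bounds the `s`-degree of `N(x + s v)^{s} = (patTop x + s·patTop v)^{s}` by `k`, i.e. (coefficient extraction)
the SUM of the words of length `s` with `j` tops vanishes for every `j > k` and `v ∈ K`; Lemma A for sums moves this to a coordinate set `E`,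
`dim K ≤ |E|`; on the `0/1` letters the sums have nonnegative integer entries and contain the row words (Lemma B), so every row path meets `E`
in `≤ k` edges and `|E| ≤ (s+1)(k+1) < dim K`. -/
theorem exists_not_slow_of_placement {s : ℕ} (hn : s + 1 ≤ 16) (V : Fin (s + 1) → Fin (s + 1) → Fin m)
    (X : Fin (s + 1) → Fin m × Fin m) (hinj : Function.Injective (placement V X))
    (hup : ∀ c, (placement V X c).1 < (placement V X c).2) :
    ∃ N : AffMat (s + 1) m, IsAffine N ∧ N ^ m = 0 ∧
      (∀ K : Submodule ℂ (Fin (s + 1) × Fin (s + 1) → ℂ), RadOrth (s + 1) m N K →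
        Module.finrank ℂ K ≤ 16 * m * Nat.sqrt (s + 1) + 16 * (s + 1)) ∧ ¬ Slow (s + 1) m N := by
  classical
  set pos := placement V X with hpos
  refine ⟨patPencil pos, isAffine_patPencil pos, patPencil_pow_eq_zero pos hup, fun K _ => ?_, ?_⟩
  · have h1 := Submodule.finrank_le K
    rw [Module.finrank_fintype_fun_eq_card, Fintype.card_prod, Fintype.card_fin] at h1
    have h2 : (s + 1) * (s + 1) ≤ 16 * (s + 1) := Nat.mul_le_mul_right _ hn
    calc Module.finrank ℂ K ≤ (s + 1) * (s + 1) := h1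
      _ ≤ 16 * (s + 1) := h2
      _ ≤ 16 * m * Nat.sqrt (s + 1) + 16 * (s + 1) := Nat.le_add_left _ _
  rintro ⟨K, k, hK, hdim⟩
  -- the word sums with `j > k` tops (length `s`) vanish on `K`
  let 𝒮 : Set (Finset (List Bool)) :=
    {S | ∃ j, k < j ∧ S = (Finset.univ.filter fun f : Fin s → Bool => (List.ofFn f).count true = j).image List.ofFn}
  have hK' : ∀ x v : Fin (s + 1) × Fin (s + 1) → ℂ, v ∈ K → ∀ S ∈ 𝒮,
      ∑ w ∈ S, word (patTop pos x) (patTop pos v) w = 0 := by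
    rintro x v hv S ⟨j, hj, rfl⟩
    rw [Finset.sum_image fun f _ g _ h => List.ofFn_injective h]
    ext i i'
    have hdeg := hK x v hv i i'
    rw [patPencil_map_lineSubst, Nat.add_sub_cancel] at hdeg
    have hsum : ∑ i ∈ (Finsupp.single (0 : Fin 1) j).support, (Finsupp.single (0 : Fin 1) j) i = j := by
      rw [Finsupp.support_single _ (by omega : j ≠ 0), Finset.sum_singleton, Finsupp.single_eq_same]
    have hcoeff := MvPolynomial.coeff_eq_zero_of_totalDegree_lt (d := Finsupp.single (0 : Fin 1) j)
      (lt_of_le_of_lt hdeg (by rw [hsum]; exact hj))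
    rw [coeff_pow_line_eq_sum_gword] at hcoeff
    simpa [word_eq_gword] using hcoeff
  obtain ⟨E, hKE, hE⟩ := wordsums_vanish_on_coordinate_of_vanish pos hinj hup K 𝒮 hK'
  -- each row path meets `E` in at most `k` edges
  have hrow : ∀ a : Fin (s + 1),
      (Finset.univ.filter fun i : Fin s => ((a, i.castSucc) : Fin (s + 1) × Fin (s + 1)) ∈ E).card ≤ k := by
    intro a
    by_contra hlt
    push Not at hlt
    have hs : 0 < s := by
      by_contra hs0
      have : s = 0 := by omega
      subst this
      simp at hlt
    have hcount : (List.ofFn fun i : Fin s => decide (((a, i.castSucc) : Fin (s + 1) × Fin (s + 1)) ∈ E)).count true =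
        (Finset.univ.filter fun i : Fin s => ((a, i.castSucc) : Fin (s + 1) × Fin (s + 1)) ∈ E).card := by
      rw [count_true_ofFn]
      simp
    refine wordsum_indicator_ne_zero V X E a hs ?_
    have hmem : (Finset.univ.filter fun f : Fin s → Bool => (List.ofFn f).count true =
        (List.ofFn fun i : Fin s => decide (((a, i.castSucc) : Fin (s + 1) × Fin (s + 1)) ∈ E)).count true).image
          List.ofFn ∈ 𝒮 := ⟨_, by rw [hcount]; exact hlt, rfl⟩
    have h := hE (fun _ => 1) (fun d => if d ∈ E then 1 else 0) (fun c hc => if_neg hc) _ hmem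
    rwa [Finset.sum_image fun f _ g _ h => List.ofFn_injective h] at h
  -- fibres and the count, as in `not_heavyTopInst_of_placement`
  have hfib : ∀ a : Fin (s + 1), (E.filter fun c => c.1 = a).card ≤ k + 1 := by
    intro a
    have hsub : E.filter (fun c => c.1 = a) ⊆ insert (a, Fin.last s)
        ((Finset.univ.filter fun i : Fin s => ((a, i.castSucc) : Fin (s + 1) × Fin (s + 1)) ∈ E).image
          fun i => (a, i.castSucc)) := by
      intro c hc
      rw [Finset.mem_filter] at hc
      obtain ⟨hcE, hca⟩ := hc
      rw [Finset.mem_insert, Finset.mem_image]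
      rcases Fin.eq_castSucc_or_eq_last c.2 with ⟨i, hi⟩ | hlast
      · right
        have hci : c = (a, i.castSucc) := Prod.ext hca hi
        refine ⟨i, ?_, hci.symm⟩
        rw [Finset.mem_filter]
        exact ⟨Finset.mem_univ _, hci ▸ hcE⟩
      · left
        exact Prod.ext hca hlast
    calc (E.filter fun c => c.1 = a).card
        ≤ (insert (a, Fin.last s) ((Finset.univ.filter fun i : Fin s =>
            ((a, i.castSucc) : Fin (s + 1) × Fin (s + 1)) ∈ E).image fun i => (a, i.castSucc))).card :=
          Finset.card_le_card hsub
      _ ≤ ((Finset.univ.filter fun i : Fin s => ((a, i.castSucc) : Fin (s + 1) × Fin (s + 1)) ∈ E).image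
            fun i => (a, i.castSucc)).card + 1 := Finset.card_insert_le _ _
      _ ≤ (Finset.univ.filter fun i : Fin s => ((a, i.castSucc) : Fin (s + 1) × Fin (s + 1)) ∈ E).card + 1 :=
          Nat.add_le_add_right Finset.card_image_le 1
      _ ≤ k + 1 := Nat.add_le_add_right (hrow a) 1
  have hcardE : E.card ≤ (s + 1) * (k + 1) := by
    calc E.card = ∑ a : Fin (s + 1), (E.filter fun c => c.1 = a).card :=
          Finset.card_eq_sum_card_fiberwise fun c _ => Finset.mem_univ c.1
      _ ≤ ∑ _a : Fin (s + 1), (k + 1) := Finset.sum_le_sum fun a _ => hfib a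
      _ = (s + 1) * (k + 1) := by simp
  have h3 : (k + 1) * (s + 1) = (s + 1) * (k + 1) := Nat.mul_comm _ _
  omega

/-- Monotonicity in `m` for placements, power currency. -/
theorem exists_not_slow_of_placement_le {s m' : ℕ} (hmm' : m ≤ m') (hn : s + 1 ≤ 16) (V : Fin (s + 1) → Fin (s + 1) → Fin m)
    (X : Fin (s + 1) → Fin m × Fin m) (hinj : Function.Injective (placement V X))
    (hup : ∀ c, (placement V X c).1 < (placement V X c).2) :
    ∃ N : AffMat (s + 1) m', IsAffine N ∧ N ^ m' = 0 ∧
      (∀ K : Submodule ℂ (Fin (s + 1) × Fin (s + 1) → ℂ), RadOrth (s + 1) m' N K →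
        Module.finrank ℂ K ≤ 16 * m' * Nat.sqrt (s + 1) + 16 * (s + 1)) ∧ ¬ Slow (s + 1) m' N := by
  let e : Fin m → Fin m' := Fin.castLE hmm'
  have he : Function.Injective e := Fin.castLE_injective hmm'
  have hplace : ∀ c, placement (fun a i => e (V a i)) (fun a => (e (X a).1, e (X a).2)) c =
      (e (placement V X c).1, e (placement V X c).2) := by
    intro c
    unfold placement
    split_ifs <;> rfl
  refine exists_not_slow_of_placement hn (fun a i => e (V a i)) (fun a => (e (X a).1, e (X a).2)) ?_ ?_
  · intro c d hcd
    rw [hplace, hplace] at hcd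
    apply hinj
    exact Prod.ext (he (Prod.mk.inj hcd).1) (he (Prod.mk.inj hcd).2)
  · intro c
    rw [hplace]
    exact (Fin.castLE_lt_castLE_iff hmm').2 (hup c)

end SlowTwin

end Summit.ValiantsHypothesis.ValiantsHypothesis.Theorems.GrenetZeon.RadicalSplit

end
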